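import Literature.Geometry.Lorentzian.LandauLifshitzPseudotensor
import Literature.Analysis.Calculus.MatrixFieldDeriv
import Mathlib.Analysis.Calculus.FDeriv.Symmetric

/-!
# Stub `stub_pseudotensorBound` (line `sublinear-is-free-clean-window-charges`), part 2:
# pointwise calculus of the components, the determinant, the inverse and the Christoffel map

Helper file for `stmt-FinalStateConjecture-10166` (crux `InertialRecession`). For a field of
bilinear forms `g : E4 → (E4 →L E4 →L ℝ)` which is only `C²` AT a point `x` (`ContDiffAt ℝ 2 g x`,
the regularity of the stub) we record the first-order calculus that the Landau–Lifshitz objects of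
`LandauLifshitzPseudotensor.lean` are built from, in the form needed to expand
`emComplex = (16π)⁻¹ Σ ∂∂H` and `ricci` in the `2`-jet of `g` at `x`:

* regularity bookkeeping: `g` is differentiable near `x`, `Dg` is differentiable at `x`, `D²g(x)`
  is symmetric, evaluation on constant vectors commutes with `fderiv`
  (`fderiv_apply₂`, `fderiv_fderiv_apply₃`), symmetry of `Dg`, `D²g` in the form slots;
* `fderiv_metricDet` — Jacobi: `∂_v det(g_{μν}) = det(g_{μν}) Σ g^{ρσ} ∂_v g_{σρ}`, and
  `fderiv_upper` — `∂_v g^{ij} = −Σ g^{ik} g^{lj} ∂_v g_{kl}` (from the tree's `MatrixFieldDeriv`);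
* `isInvertible_of_metricDet_ne_zero`, `eventually_metricDet_ne_zero`;
* `differentiableAt_chrAt` — the Christoffel map `Γ = ½ ♯ ∘ K(Dg)` of `CoordCurvature.lean` is
  differentiable at `x`, and `chrAt_coord` — its components are the classical
  `Γ^m_{pq} = ½ g^{ml}(∂_p g_{ql} + ∂_q g_{lp} − ∂_l g_{pq})` (O'Neill 1983, Prop. 3.13).

No definitions. Sources: Landau–Lifshitz §96, §92; O'Neill 1983, Ch. 3.
-/

noncomputable section

set_option linter.dupNamespace false
-- instance search on the nested operator spaces needs a deeper pending depth (as in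
-- `CoordCurvature.lean`)
set_option maxSynthPendingDepth 3

open Filter Set
open scoped Topology Matrix

namespace Summit.FinalStateConjecture.FinalStateConjecture.Theorems.SublinearIsFree.PseudotensorBound

open Literature.Geometry.Lorentzian Literature.Geometry.Lorentzian.LandauLifshitz
  Literature.Analysis.Calculus

variable {g : E4 → E4 →L[ℝ] E4 →L[ℝ] ℝ} {x y : E4}

/-! ### Coordinates on `E4` (private copies of the part-1 lemmas, to keep the files independent) -/

/-- `v = Σ_μ v^μ ∂_μ` on `E4`. [folklore] -/
private theorem eq_sum_smul_basisVector' (v : E4) : v = ∑ μ, v μ • E4.basisVector μ := by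
  have h := (EuclideanSpace.basisFun (Fin 4) ℝ).sum_repr' v
  conv_lhs => rw [← h]
  simp [EuclideanSpace.inner_single_left]

/-- `g_y(v, ∂_ν) = (v ᵥ* (g_{μν}))_ν`. [folklore] -/
private theorem apply_basisVector_eq_vecMul' (v : E4) (ν : Fin 4) :
    g y v (E4.basisVector ν) = ((fun μ ↦ v μ) ᵥ* gram g y) ν := by
  conv_lhs => rw [eq_sum_smul_basisVector' v]
  simp only [map_sum, map_smul, _root_.sum_apply, _root_.smul_apply, smul_eq_mul]
  rw [Matrix.vecMul, dotProduct]
  rfl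

/-! ### Regularity bookkeeping for `ContDiffAt ℝ 2 g x` -/

/-- `g` is differentiable at `x`. [folklore] -/
theorem differentiableAt_of_contDiffAt (hg : ContDiffAt ℝ 2 g x) : DifferentiableAt ℝ g x :=
  hg.differentiableAt (by norm_num)

/-- `g` is differentiable near `x`. [folklore] -/
theorem eventually_differentiableAt (hg : ContDiffAt ℝ 2 g x) :
    ∀ᶠ y in 𝓝 x, DifferentiableAt ℝ g y :=
  (hg.eventually (by simp)).mono fun _ hy ↦ hy.differentiableAt (by norm_num)

/-- `Dg` is differentiable at `x`. [folklore] -/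
theorem differentiableAt_fderiv (hg : ContDiffAt ℝ 2 g x) : DifferentiableAt ℝ (fderiv ℝ g) x :=
  (hg.fderiv_right (m := 1) (by norm_num)).differentiableAt (by norm_num)

/-- `D²g(x)` is symmetric: `D²g(x)(v)(w) = D²g(x)(w)(v)`. [folklore] -/
theorem fderiv_fderiv_comm (hg : ContDiffAt ℝ 2 g x) (v w : E4) :
    fderiv ℝ (fderiv ℝ g) x v w = fderiv ℝ (fderiv ℝ g) x w v :=
  hg.isSymmSndFDerivAt (by simp [minSmoothness_of_isRCLikeNormedField]) v w

/-- `∂_v (g(·)(Y, Z))(y) = Dg(y)(v)(Y)(Z)`. [folklore] -/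
theorem fderiv_apply₂ (hgy : DifferentiableAt ℝ g y) (Y Z v : E4) :
    fderiv ℝ (fun z ↦ g z Y Z) y v = fderiv ℝ g y v Y Z := by
  have h1 : DifferentiableAt ℝ (fun z ↦ g z Y) y := MetricCoord.differentiableAt_clm_apply_const hgy Y
  rw [MetricCoord.fderiv_clm_apply_const h1 Z v, MetricCoord.fderiv_clm_apply_const hgy Y v]

/-- `y ↦ g_y(Y, Z)` is differentiable where `g` is. [folklore] -/
theorem differentiableAt_apply₂ (hgy : DifferentiableAt ℝ g y) (Y Z : E4) :
    DifferentiableAt ℝ (fun z ↦ g z Y Z) y :=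
  MetricCoord.differentiableAt_clm_apply_const (MetricCoord.differentiableAt_clm_apply_const hgy Y) Z

/-- `∂_v (Dg(·)(w)(Y)(Z))(x) = D²g(x)(v)(w)(Y)(Z)`. [folklore] -/
theorem fderiv_fderiv_apply₃ (hg : ContDiffAt ℝ 2 g x) (w Y Z v : E4) :
    fderiv ℝ (fun y ↦ fderiv ℝ g y w Y Z) x v = fderiv ℝ (fderiv ℝ g) x v w Y Z := by
  have hD := differentiableAt_fderiv hg
  have h1 : DifferentiableAt ℝ (fun y ↦ fderiv ℝ g y w) x := MetricCoord.differentiableAt_clm_apply_const hD w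
  have h2 : DifferentiableAt ℝ (fun y ↦ fderiv ℝ g y w Y) x :=
    MetricCoord.differentiableAt_clm_apply_const h1 Y
  rw [MetricCoord.fderiv_clm_apply_const h2 Z v, MetricCoord.fderiv_clm_apply_const h1 Y v,
    MetricCoord.fderiv_clm_apply_const hD w v]

/-- `y ↦ Dg(y)(w)(Y)(Z)` is differentiable at `x`. [folklore] -/
theorem differentiableAt_fderiv_apply₃ (hg : ContDiffAt ℝ 2 g x) (w Y Z : E4) :
    DifferentiableAt ℝ (fun y ↦ fderiv ℝ g y w Y Z) x :=
  MetricCoord.differentiableAt_clm_apply_const (MetricCoord.differentiableAt_clm_apply_const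
    (MetricCoord.differentiableAt_clm_apply_const (differentiableAt_fderiv hg) w) Y) Z

/-- Symmetric components have symmetric first derivatives: `Dg(y)(v)(Y)(Z) = Dg(y)(v)(Z)(Y)`.
[folklore] -/
theorem fderiv_symm (hgy : DifferentiableAt ℝ g y) (hs : ∀ᶠ z in 𝓝 y, ∀ v w : E4, g z v w = g z w v)
    (v Y Z : E4) : fderiv ℝ g y v Y Z = fderiv ℝ g y v Z Y := by
  rw [← fderiv_apply₂ hgy, ← fderiv_apply₂ hgy]
  have heq : (fun z ↦ g z Y Z) =ᶠ[𝓝 y] fun z ↦ g z Z Y := hs.mono fun z hz ↦ hz Y Z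
  rw [heq.fderiv_eq]

/-- Symmetric components have symmetric second derivatives in the form slots:
`D²g(x)(v)(w)(Y)(Z) = D²g(x)(v)(w)(Z)(Y)`. [folklore] -/
theorem fderiv_fderiv_symm (hg : ContDiffAt ℝ 2 g x)
    (hs : ∀ᶠ z in 𝓝 x, ∀ v w : E4, g z v w = g z w v) (v w Y Z : E4) :
    fderiv ℝ (fderiv ℝ g) x v w Y Z = fderiv ℝ (fderiv ℝ g) x v w Z Y := by
  rw [← fderiv_fderiv_apply₃ hg, ← fderiv_fderiv_apply₃ hg]
  have heq : (fun y ↦ fderiv ℝ g y w Y Z) =ᶠ[𝓝 x] fun y ↦ fderiv ℝ g y w Z Y := by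
    filter_upwards [eventually_differentiableAt hg, hs.eventually_nhds] with y hy hsy
    exact fderiv_symm hy hsy w Y Z
  rw [heq.fderiv_eq]

/-! ### The component field as a matrix field: Jacobi and the derivative of the inverse -/

/-- The component field `z ↦ (g_z(∂_i, ∂_j))_{ij}` has derivative `v ↦ (Dg(y)(v)(∂_i)(∂_j))_{ij}`.
[folklore] -/
theorem hasFDerivAt_gramFun (hgy : DifferentiableAt ℝ g y) :
    HasFDerivAt (fun z (i j : Fin 4) ↦ g z (E4.basisVector i) (E4.basisVector j))
      (ContinuousLinearMap.pi fun i ↦ ContinuousLinearMap.pi fun j ↦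
        ((fderiv ℝ g y).flip (E4.basisVector i)).flip (E4.basisVector j)) y :=
  hasFDerivAt_pi.2 fun i ↦ hasFDerivAt_pi.2 fun j ↦
    MetricCoord.hasFDerivAt_clm_apply_const
      (MetricCoord.hasFDerivAt_clm_apply_const hgy.hasFDerivAt (E4.basisVector i)) (E4.basisVector j)

/-- `metricDet g` is differentiable where `g` is. [folklore] -/
theorem differentiableAt_metricDet (hgy : DifferentiableAt ℝ g y) :
    DifferentiableAt ℝ (metricDet g) y :=
  (hasFDerivAt_det (hasFDerivAt_gramFun hgy)).differentiableAt

/-- **Jacobi's formula for the metric determinant**: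
`∂_v det(g_{μν})(y) = det(g_{μν}(y)) · Σ_{ρσ} g^{ρσ}(y) ∂_v g_{σρ}(y)`. [folklore] -/
theorem fderiv_metricDet (hgy : DifferentiableAt ℝ g y) (hdet : metricDet g y ≠ 0) (v : E4) :
    fderiv ℝ (metricDet g) y v = metricDet g y * ∑ t1, ∑ t2, upper g y t1 t2 *
      fderiv ℝ g y v (E4.basisVector t2) (E4.basisVector t1) := by
  have h := hasFDerivAt_det (hasFDerivAt_gramFun hgy)
  have h2 := hasFDerivAt_det_apply_eq_det_mul_trace
    (A := fun z (i j : Fin 4) ↦ g z (E4.basisVector i) (E4.basisVector j))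
    (A' := ContinuousLinearMap.pi fun i ↦ ContinuousLinearMap.pi fun j ↦
      ((fderiv ℝ g y).flip (E4.basisVector i)).flip (E4.basisVector j)) (y := y) hdet v
  rw [show metricDet g = fun z ↦ (Matrix.of fun i j ↦ g z (E4.basisVector i) (E4.basisVector j)).det
    from rfl, h.fderiv, h2]
  simp only [Matrix.trace, Matrix.diag, Matrix.mul_apply, Matrix.of_apply,
    ContinuousLinearMap.pi_apply, ContinuousLinearMap.flip_apply]
  rfl

/-- The inverse components `z ↦ g^{ij}(z)` are differentiable where `g` is and `det ≠ 0`. [folklore] -/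
theorem differentiableAt_upper (hgy : DifferentiableAt ℝ g y) (hdet : metricDet g y ≠ 0) (i j : Fin 4) :
    DifferentiableAt ℝ (fun z ↦ upper g z i j) y :=
  differentiableAt_inv_apply (hasFDerivAt_gramFun hgy) hdet i j

/-- **The derivative of the inverse components**:
`∂_v g^{ij}(y) = −Σ_{kl} g^{ik}(y) g^{lj}(y) ∂_v g_{kl}(y)`. [folklore] -/
theorem fderiv_upper (hgy : DifferentiableAt ℝ g y) (hdet : metricDet g y ≠ 0) (i j : Fin 4) (v : E4) :
    fderiv ℝ (fun z ↦ upper g z i j) y v = -∑ v1, ∑ v2, upper g y i v1 * upper g y v2 j *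
      fderiv ℝ g y v (E4.basisVector v1) (E4.basisVector v2) := by
  have h := hasFDerivAt_inv_apply (hasFDerivAt_gramFun hgy) hdet i j
  rw [show (fun z ↦ upper g z i j) =
    fun z ↦ (Matrix.of fun i j ↦ g z (E4.basisVector i) (E4.basisVector j))⁻¹ i j from rfl, h.fderiv]
  simp only [_root_.neg_apply, _root_.sum_apply, _root_.smul_apply, ContinuousLinearMap.comp_apply,
    ContinuousLinearMap.proj_apply, ContinuousLinearMap.pi_apply, ContinuousLinearMap.flip_apply,
    smul_eq_mul]
  rfl

/-! ### Invertibility near `x` -/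

/-- `det (g_{μν}(y)) ≠ 0` implies that `g y : E4 → E4*` is invertible. [folklore] -/
theorem isInvertible_of_metricDet_ne_zero (hdet : metricDet g y ≠ 0) : (g y).IsInvertible := by
  refine MetricCoord.isInvertible_of_nondegenerate fun v hv ↦ ?_
  have hvec : (fun μ ↦ v μ) ᵥ* gram g y = 0 := by
    funext ν
    rw [← apply_basisVector_eq_vecMul', hv]
    rfl
  have h0 : (fun μ ↦ v μ) = 0 := Matrix.eq_zero_of_vecMul_eq_zero hdet hvec
  rw [eq_sum_smul_basisVector' v]
  simp [show ∀ μ, v μ = 0 from fun μ ↦ congr_fun h0 μ]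

/-- `det (g_{μν}) ≠ 0` near `x` if it holds at `x`. [folklore] -/
theorem eventually_metricDet_ne_zero (hg : ContDiffAt ℝ 2 g x) (hdet : metricDet g x ≠ 0) :
    ∀ᶠ y in 𝓝 x, metricDet g y ≠ 0 :=
  (differentiableAt_metricDet (differentiableAt_of_contDiffAt hg)).continuousAt.eventually_ne hdet

/-- Symmetry at the point from symmetry nearby. [folklore] -/
theorem symm_self (hs : ∀ᶠ z in 𝓝 x, ∀ v w : E4, g z v w = g z w v) (v w : E4) :
    g x v w = g x w v :=
  hs.self_of_nhds v w

/-! ### The Christoffel map: differentiability at `x` and components -/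

/-- `♯ = (g ·)⁻¹` is differentiable at `x` (inversion is smooth at invertible maps). [folklore] -/
theorem differentiableAt_sharpAt (hg : ContDiffAt ℝ 2 g x) (hi : (g x).IsInvertible) :
    DifferentiableAt ℝ (MetricCoord.sharpAt g) x :=
  ((hi.contDiffAt_map_inverse (n := 2)).comp x hg).differentiableAt (by norm_num)

/-- The Koszul form `K = koszulOp ∘ Dg` is differentiable at `x`. [folklore] -/
theorem differentiableAt_koszulCLM (hg : ContDiffAt ℝ 2 g x) :
    DifferentiableAt ℝ (MetricCoord.koszulCLM g) x :=
  (MetricCoord.koszulOp (E := E4)).differentiableAt.comp x (differentiableAt_fderiv hg)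

/-- **The Christoffel map `Γ = ½ ♯ ∘ K` is differentiable at `x`.** [folklore] -/
theorem differentiableAt_chrAt (hg : ContDiffAt ℝ 2 g x) (hi : (g x).IsInvertible) :
    DifferentiableAt ℝ (MetricCoord.chrAt g) x := by
  have h : MetricCoord.chrAt g = fun y ↦ (2⁻¹ : ℝ) •
      ((ContinuousLinearMap.compL ℝ E4 (E4 →L[ℝ] ℝ) E4 (MetricCoord.sharpAt g y)).comp
        (MetricCoord.koszulCLM g y)) := rfl
  rw [h]
  exact ((((ContinuousLinearMap.compL ℝ E4 (E4 →L[ℝ] ℝ) E4).differentiableAt).comp x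
    (differentiableAt_sharpAt hg hi)).clm_comp (differentiableAt_koszulCLM hg)).const_smul (2⁻¹ : ℝ)

/-- `∂_v (Γ(·)(X, Y))(x) = DΓ(x)(v)(X)(Y)`. [folklore] -/
theorem fderiv_chrAt_apply₂ (hg : ContDiffAt ℝ 2 g x) (hi : (g x).IsInvertible) (X Y v : E4) :
    fderiv ℝ (fun y ↦ MetricCoord.chrAt g y X Y) x v = fderiv ℝ (MetricCoord.chrAt g) x v X Y := by
  have hD := differentiableAt_chrAt hg hi
  have h1 : DifferentiableAt ℝ (fun y ↦ MetricCoord.chrAt g y X) x :=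
    MetricCoord.differentiableAt_clm_apply_const hD X
  rw [MetricCoord.fderiv_clm_apply_const h1 Y v, MetricCoord.fderiv_clm_apply_const hD X v]

/-- `∂_v (Γ(·)(X, Y)^m)(x) = (DΓ(x)(v)(X)(Y))^m` for the `m`-th coordinate. [folklore] -/
theorem fderiv_chrAt_coord (hg : ContDiffAt ℝ 2 g x) (hi : (g x).IsInvertible) (X Y v : E4)
    (m : Fin 4) :
    fderiv ℝ (fun y ↦ (MetricCoord.chrAt g y X Y) m) x v = (fderiv ℝ (MetricCoord.chrAt g) x v X Y) m := by
  have hD := differentiableAt_chrAt hg hi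
  have h2 : DifferentiableAt ℝ (fun y ↦ MetricCoord.chrAt g y X Y) x :=
    MetricCoord.differentiableAt_clm_apply_const (MetricCoord.differentiableAt_clm_apply_const hD X) Y
  have h3 := (EuclideanSpace.proj (𝕜 := ℝ) m).hasFDerivAt.comp x h2.hasFDerivAt
  rw [show (fun y ↦ (MetricCoord.chrAt g y X Y) m) =
      (EuclideanSpace.proj (𝕜 := ℝ) m) ∘ fun y ↦ MetricCoord.chrAt g y X Y from rfl, h3.fderiv,
    ContinuousLinearMap.comp_apply, fderiv_chrAt_apply₂ hg hi]
  rfl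

/-- **Components of the Christoffel map**: for invertible symmetric `g y`,
`Γ_y(∂_p, ∂_q)^m = ½ Σ_l g^{ml}(∂_p g_{ql} + ∂_q g_{lp} − ∂_l g_{pq})`
(O'Neill 1983, Ch. 3, Prop. 3.13; LL (86.3)). [cite: LandauLifshitz1975, §86 (86.3)] -/
theorem chrAt_coord (hi : (g y).IsInvertible) (hs : ∀ v w : E4, g y v w = g y w v) (p q m : Fin 4) :
    (MetricCoord.chrAt g y (E4.basisVector p) (E4.basisVector q)) m =
      2⁻¹ * ∑ l, upper g y m l *
        (fderiv ℝ g y (E4.basisVector p) (E4.basisVector q) (E4.basisVector l)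
          + fderiv ℝ g y (E4.basisVector q) (E4.basisVector l) (E4.basisVector p)
          - fderiv ℝ g y (E4.basisVector l) (E4.basisVector p) (E4.basisVector q)) := by
  set γ : E4 := MetricCoord.chrAt g y (E4.basisVector p) (E4.basisVector q) with hγ
  set K : Fin 4 → ℝ := fun l ↦
    fderiv ℝ g y (E4.basisVector p) (E4.basisVector q) (E4.basisVector l)
      + fderiv ℝ g y (E4.basisVector q) (E4.basisVector l) (E4.basisVector p)
      - fderiv ℝ g y (E4.basisVector l) (E4.basisVector p) (E4.basisVector q) with hK
  have hdet : metricDet g y ≠ 0 := by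
    intro h0
    obtain ⟨c, hc, hcA⟩ := Matrix.exists_vecMul_eq_zero_iff.mpr h0
    apply hc
    have hv : g y (WithLp.toLp 2 c) = 0 := by
      refine ContinuousLinearMap.ext fun w ↦ ?_
      rw [eq_sum_smul_basisVector' w, map_sum, _root_.zero_apply]
      refine Finset.sum_eq_zero fun ν _ ↦ ?_
      rw [map_smul, apply_basisVector_eq_vecMul', smul_eq_mul]
      simp [hcA]
    have h1 := MetricCoord.sharpAt_apply hi (WithLp.toLp 2 c)
    rw [hv, map_zero] at h1
    exact (WithLp.toLp_eq_zero 2).mp h1.symm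
  -- `γ ᵥ* (g_{μν}) = ½ K`
  have hrow : (fun μ ↦ γ μ) ᵥ* gram g y = fun l ↦ 2⁻¹ * K l := by
    funext l
    rw [← apply_basisVector_eq_vecMul', hγ, MetricCoord.apply_chrAt hi]
    rfl
  have hsol : (fun μ ↦ γ μ) = (fun l ↦ 2⁻¹ * K l) ᵥ* upper g y := by
    rw [← hrow, Matrix.vecMul_vecMul, upper, Matrix.mul_nonsing_inv _ (isUnit_iff_ne_zero.mpr hdet),
      Matrix.vecMul_one]
  have h := congr_fun hsol m
  simp only at h
  rw [h, Matrix.vecMul, dotProduct, Finset.mul_sum]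
  refine Finset.sum_congr rfl fun l _ ↦ ?_
  rw [upper_comm hs m l]
  ring

/-! ### Registered sub-goal form -/

/-- Registered sub-goal form (part 2): Jacobi's formula and the derivative of the inverse components. [folklore] -/
theorem pseudotensorBound_fderiv_metricDet_upper : open Literature.Geometry.Lorentzian in ∀ {g : E4 → E4 →L[ℝ] E4 →L[ℝ] ℝ} {y : E4}, DifferentiableAt ℝ g y → LandauLifshitz.metricDet g y ≠ 0 → ∀ (i j : Fin 4) (v : E4), fderiv ℝ (LandauLifshitz.metricDet g) y v = LandauLifshitz.metricDet g y * ∑ t1, ∑ t2, LandauLifshitz.upper g y t1 t2 * fderiv ℝ g y v (E4.basisVector t2) (E4.basisVector t1) ∧ fderiv ℝ (fun z ↦ LandauLifshitz.upper g z i j) y v = -∑ v1, ∑ v2, LandauLifshitz.upper g y i v1 * LandauLifshitz.upper g y v2 j * fderiv ℝ g y v (E4.basisVector v1) (E4.basisVector v2) :=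
  fun hgy hdet i j v ↦ ⟨fderiv_metricDet hgy hdet v, fderiv_upper hgy hdet i j v⟩

end Summit.FinalStateConjecture.FinalStateConjecture.Theorems.SublinearIsFree.PseudotensorBound

end
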